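import Literature.NumberTheory.EllipticCurves.Rank1Residual.PrintShape
import HarnessLib

/-!
# The print shape of "the `p`-part of the BSD formula" WITH the torsion term (reducible `E[p]` allowed), and its bridge to Miller's `BSD(E,p)`

Companion of `Rank1Residual/PrintShape.lean` (prover x11a: the NO-torsion print shape under irr(p),
`bsdp_of_padicVal_printShape`). The Eisenstein classes (X1–X3: `E[p]` REDUCIBLE, rational `p`-torsion
possible, e.g. `11a1@5`) need the general shape with the torsion term `(#E(ℚ)_tor)²`, which is the one
printed by Yan–Zhu 2026 Thm. 4.15 and Keller–Yin 2024 Thm. 3 and transcribed by the tree's bsd.S30.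

HONEST FRAMING (cell `b2b-bsdres`): the goal of the cell is to DELETE the COMBINATION-SHAPED
residual classes of the BSD formula for ALL analytic-rank `≤ 1` curves over `ℚ` from PUBLISHED
theorems only, and to TYPE the construction-shaped classes (missing-input `Prop`s), not to attempt
them; this is not "finishing BSD".

Theorems only (no named fact; D-0026). The published `p`-part theorems the cell vendors
(`Literature/NumberTheory/EllipticCurves/<AuthorYear>/…`) all conclude with one of three printed
shapes, for an elliptic curve `E/ℚ` with `r = ord_{s=1} L(E,s) ∈ {0,1}`:

* (general) `|L^{(r)}(1,E)/(r!·Ω_E·R_E)|_p = |#Ш(E)[p^∞]·∏_{ℓ∣N} c_ℓ(E)/(#E(ℚ)_tor)²|_p`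
  (Yan–Zhu, J. Algebra (2026) Thm. 4.15; Keller–Yin 2024 Thm. 3) — `PPart W p` below;
* (no torsion term) `|L^{(r)}(E,1)/(Reg(E)·Ω_E)|_p^{-1} = |#Ш(E)·∏_{ℓ∤∞} c_ℓ(E)|_p^{-1}`
  (Burungale–Castella–Skinner 2025 Cor. 1.3.1; Jetchev–Skinner–Wan 2017 Thm. 1.2.1; Castella 2018)
  — the sibling file's hypothesis shape; under these theorems' hypothesis irr(p), `E(ℚ)[p] = 0` so the two agree;
* (rank `0`) `|L(E,1)/Ω_E|_p^{-1} = |#Ш(E)·∏ c_ℓ|_p^{-1}` (Skinner 2016 Thm. C; Skinner–Urban 2014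
  Thm. 2(a) = the tree's bsd.S30 `padicValRat_bsd_rank_zero` shape, which carries the torsion term)
  — `PPartRankZero W p`.

Here `Ω_E = W.realPeriodRat` (Néron period of a globally minimal `W`, components included),
`R_E = Reg = W.regulator` (Gram determinant of the Néron–Tate pairing, `= 1` in rank `0`:
`regulator_eq_one_of_rank_zero`), `L^{(r)}(1,E)/r! = W.leadingLCoeff`, `#Ш = W.shaOrder` (finite
`Ш` — a theorem for `r ≤ 1`, bsd.S17), `∏ c_ℓ = W.tamagawaProduct`, `#E(ℚ)_tor = W.torsionOrder`,
exactly the dictionary of bsd.S30 and of `BSDRootNumberSmallConductorProofs` (Miller's `#Ш_an`,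
`shaAn W`, and `BSD(E,p)`, `BSDp W p`).

Proved here: `bsdp_of_pPart` — in analytic rank `≤ 1`, the general print shape implies Miller's
`BSD(E,p)` (`BSDp W p`: `rank = r_an`, `Ш(p)` finite, `#Ш_an ∈ ℚ`, `ord_p #Ш_an = ord_p #Ш(p)`),
given Gross–Zagier–Kolyvagin (bsd.S17, the named fact `rank_eq_analyticRank_of_analyticRank_le_one`,
hypothesis `hGZK`) and modularity (`hasEntireLFunction_rat`, hypothesis `hmod`, for
`L^{(r)}(E,1) ≠ 0`); the conversions `pPart_of_noTorsionShape` (under irr(p), via the sibling file's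
`padicValNat_torsionOrder_eq_zero_of_irreducible`) and `pPart_of_pPartRankZero` (needs `r_an = 0`; uses `Reg = 1` in rank `0` via `hGZK`). So a class
theorem of the cell is: class predicate ⇒ hypotheses of a vendored fact ⇒ its print shape ⇒
`BSDp W p`.

References: Miller, LMS J. Comput. Math. 14 (2011) Def. 1.1 (`Miller2011LMS`); Yan–Zhu 2026
Thm. 4.15 (`YanZhu2026`); Burungale–Castella–Skinner 2025 Cor. 1.3.1 (`BurungaleCastellaSkinner2025`);
Skinner 2016 Thm. C (`Skinner2016PacificMC`); Darmon 2004 Thm. 3.22 (bsd.S17).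
-/

noncomputable section

open scoped Classical

open WeierstrassCurve Literature.NumberTheory.EllipticCurves

namespace Literature.NumberTheory.EllipticCurves.Rank1Residual

/-- **The print shape of the `p`-part of BSD, general form** (Yan–Zhu, J. Algebra (2026), Thm. 4.15,
display: `|L^{(r)}(1,E)/(r!·Ω_E R_E)|_p = |#Ш(E)[p^∞]·∏_{ℓ∣N} c_ℓ(E)/(#E(ℚ)_tor)²|_p`): the
quotient `L^{(r)}(E,1)/(r!·Ω_E·Reg(E))` is a rational number `q` with
`ord_p q = ord_p #Ш + ord_p ∏ c_ℓ − 2·ord_p #E(ℚ)_tors` (tree dictionary in the module docstring;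
`ord_p #Ш(E)[p^∞] = ord_p #Ш(E)` for finite `Ш`). A predicate on `(W, p)`, not a fact.
[cite: YanZhu2026, Thm. 4.15 (display)] -/
def PPart (W : WeierstrassCurve ℚ) (p : ℕ) : Prop :=
  ∃ q : ℚ, W.leadingLCoeff / ((W.realPeriodRat * W.regulator : ℝ) : ℂ) = (q : ℂ) ∧
    padicValRat p q = (padicValNat p W.shaOrder : ℤ) + padicValNat p W.tamagawaProduct -
      2 * padicValNat p W.torsionOrder

/-- **The rank-zero print shape** (Skinner, Pacific J. Math. 283 (2016), Thm. C:
`|L(E,1)/Ω_E|_p^{-1} = |#Ш(E)∏_ℓ c_ℓ(E)|_p^{-1}`; with the torsion term, as in Skinner–Urban 2014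
Thm. 2(a) transcribed by the tree's bsd.S30 — under irr(p) the torsion term is a `p`-adic unit).
A predicate on `(W, p)`. [cite: Skinner2016PacificMC, Thm. C (display)] -/
def PPartRankZero (W : WeierstrassCurve ℚ) (p : ℕ) : Prop :=
  ∃ q : ℚ, W.entireLFunction 1 / (W.realPeriodRat : ℂ) = (q : ℂ) ∧
    padicValRat p q = (padicValNat p W.shaOrder : ℤ) + padicValNat p W.tamagawaProduct -
      2 * padicValNat p W.torsionOrder

variable (W : WeierstrassCurve ℚ) [W.IsElliptic] (p : ℕ) [Fact p.Prime]

omit [W.IsElliptic] [Fact p.Prime] in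
/-- Unfolding of `PPart`. [cite: YanZhu2026, Thm. 4.15 (display)] -/
theorem pPart_iff : PPart W p ↔
    ∃ q : ℚ, W.leadingLCoeff / ((W.realPeriodRat * W.regulator : ℝ) : ℂ) = (q : ℂ) ∧
      padicValRat p q = (padicValNat p W.shaOrder : ℤ) + padicValNat p W.tamagawaProduct -
        2 * padicValNat p W.torsionOrder := Iff.rfl

omit [Fact p.Prime] in
/-- The rank-zero print shape gives the general one when `ord_{s=1} L(E,s) = 0`: then
`L^{(0)}(E,1)/0! = L(E,1)` and, by Gross–Zagier–Kolyvagin (`hGZK`, bsd.S17: `rank E(ℚ) = 0`),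
`Reg(E/ℚ) = 1` (`regulator_eq_one_of_rank_zero`). Bookkeeping. [cite: Darmon2004, Thm. 3.22] -/
theorem pPart_of_pPartRankZero (hGZK : rank_eq_analyticRank_of_analyticRank_le_one)
    (hr : W.analyticRank = 0) (h : PPartRankZero W p) : PPart W p := by
  obtain ⟨q, hq, hv⟩ := h
  have hrank : W.mordellWeilRank = 0 := by
    have := (hGZK W (by omega)).1
    omega
  refine ⟨q, ?_, hv⟩
  rw [W.regulator_eq_one_of_rank_zero hrank, mul_one, leadingLCoeff_eq_of_analyticRank_eq_zero W hr]
  exact hq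

/-- **Print shape ⇒ Miller's `BSD(E,p)` in analytic rank `≤ 1`.** If `ord_{s=1} L(E,s) ≤ 1` and the
general print shape `PPart W p` holds (for a prime `p`, `W` an elliptic curve over `ℚ`), then
`BSDp W p`: clause (i) `rank = r_an` and the finiteness of `Ш` (hence of `Ш(p)`) are
Gross–Zagier–Kolyvagin (`hGZK` = bsd.S17; Miller 2011 §1: "If `r_an(E/ℚ) ≤ 1` then all but the
last part of `BSD(E/ℚ,p)` is known"); clause (iii): `#Ш_an = q · #E(ℚ)_tors²/∏ c_ℓ ∈ ℚ` with `q` the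
rational of `PPart` (`Ω > 0`, `Reg > 0`, `∏ c_ℓ > 0`: `realPeriodRat_pos_holds`, `regulator_pos'`,
`tamagawaProduct_pos_holds`); clause (iv): `ord_p #Ш_an = ord_p q + 2 ord_p #E(ℚ)_tors − ord_p ∏ c_ℓ
= ord_p #Ш = ord_p #Ш(p)` (`padicValNat_card_addPrimaryComponent`), using `q ≠ 0`, i.e.
`L^{(r)}(E,1) ≠ 0` (`leadingLCoeff_ne_zero_holds` under modularity `hmod`).
[cite: Miller2011LMS, §1 and Def. 1.1 (arXiv:1010.2431 p. 3)] [cite: Darmon2004, Thm. 3.22] -/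
theorem bsdp_of_pPart (hmod : hasEntireLFunction_rat)
    (hGZK : rank_eq_analyticRank_of_analyticRank_le_one) (hr : W.analyticRank ≤ 1)
    (h : PPart W p) : BSDp W p := by
  obtain ⟨hrank, hfin⟩ := hGZK W hr
  haveI : Finite W.sha := hfin
  obtain ⟨q, hq, hv⟩ := h
  -- positivity of the denominators
  have hΩ : (0 : ℝ) < W.realPeriodRat := W.realPeriodRat_pos_holds
  have hR : (0 : ℝ) < W.regulator := W.regulator_pos'
  have hc0 : 0 < W.tamagawaProduct := W.tamagawaProduct_pos_holds
  have ht0 : 0 < W.torsionOrder := W.torsionOrder_pos_holds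
  have hΩR : ((W.realPeriodRat * W.regulator : ℝ) : ℂ) ≠ 0 := by
    exact_mod_cast (mul_pos hΩ hR).ne'
  -- `q ≠ 0` from `L^{(r)}(E,1) ≠ 0`
  have hLne : W.leadingLCoeff ≠ 0 := W.leadingLCoeff_ne_zero_holds (hmod W)
  have hq0 : q ≠ 0 := by
    rintro rfl
    rw [Rat.cast_zero, div_eq_zero_iff] at hq
    exact hq.elim hLne hΩR
  refine ⟨hrank, Finite.of_injective _ Subtype.val_injective,
    q * (W.torsionOrder : ℚ) ^ 2 / (W.tamagawaProduct : ℚ), ?_, ?_⟩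
  · -- `#Ш_an = q · #E(ℚ)_tors² / ∏ c_ℓ`
    have hL : W.leadingLCoeff = (q : ℂ) * ((W.realPeriodRat * W.regulator : ℝ) : ℂ) := by
      rw [← hq, div_mul_cancel₀ _ hΩR]
    have hcp : (W.tamagawaProduct : ℂ) ≠ 0 := by exact_mod_cast hc0.ne'
    have hΩ' : (W.realPeriodRat : ℂ) ≠ 0 := by exact_mod_cast hΩ.ne'
    have hR' : (W.regulator : ℂ) ≠ 0 := by exact_mod_cast hR.ne'
    rw [shaAn_def, hL]
    push_cast
    field_simp
  · -- valuations
    have ht : (W.torsionOrder : ℚ) ≠ 0 := by exact_mod_cast ht0.ne'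
    have hc : (W.tamagawaProduct : ℚ) ≠ 0 := by exact_mod_cast hc0.ne'
    rw [padicValRat.div (mul_ne_zero hq0 (pow_ne_zero 2 ht)) hc, padicValRat.mul hq0 (pow_ne_zero 2 ht),
      padicValRat.pow (W.torsionOrder : ℚ), padicValRat.of_nat, padicValRat.of_nat, hv, WeierstrassCurve.shaOrder,
      padicValNat_card_addPrimaryComponent]
    ring

/-- The rank-zero shape ⇒ `BSD(E,p)` when `ord_{s=1} L(E,s) = 0`.
[cite: Miller2011LMS, §1 and Def. 1.1] [cite: Skinner2016PacificMC, Thm. C (display)] -/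
theorem bsdp_of_pPartRankZero (hmod : hasEntireLFunction_rat)
    (hGZK : rank_eq_analyticRank_of_analyticRank_le_one) (hr : W.analyticRank = 0)
    (h : PPartRankZero W p) : BSDp W p :=
  bsdp_of_pPart W p hmod hGZK (by omega) (pPart_of_pPartRankZero W p hGZK hr h)

/-- Under irr(p) the no-torsion print shape (the hypothesis `h` of the sibling bridge
`bsdp_of_padicVal_printShape`) is the general one: `ord_p #E(ℚ)_tors = 0`
(`padicValNat_torsionOrder_eq_zero_of_irreducible`, Mazur 1977). Bookkeeping.
[cite: BurungaleCastellaSkinner2025, Cor. 1.3.1 (display)] -/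
theorem pPart_of_noTorsionShape (hirr : W.HasIrreducibleModPGaloisRep p)
    (h : ∃ q : ℚ, W.leadingLCoeff / ((W.realPeriodRat * W.regulator : ℝ) : ℂ) = (q : ℂ) ∧
      padicValRat p q = (padicValNat p W.shaOrder : ℤ) + padicValNat p W.tamagawaProduct) :
    PPart W p := by
  obtain ⟨q, hq, hv⟩ := h
  refine ⟨q, hq, ?_⟩
  rw [hv, padicValNat_torsionOrder_eq_zero_of_irreducible W p hirr]
  simp

end Literature.NumberTheory.EllipticCurves.Rank1Residual
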